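import Summits.ResolutionOfSingularities.ResolutionOfSingularities.Theorems.FrobeniusLadderFRationalResolutionTowerStep
import Mathlib.Algebra.MonoidAlgebra.Basic
import Mathlib.RingTheory.FiniteType
import HarnessLib

/-!
# Toric surface programme: `k[σ∨ ∩ ℤ²]` is of finite type (Gordan's lemma for the cone `{0 ≤ m₂, a m₂ ≤ r m₁}`)

Support file for crux stmt-ResolutionOfSingularities-15317 (`FrobeniusLadder.FRationalResolution`),
line `redirect`, lead c4 (toric surface programme for rung 4′: all affine toric surfaces
`U(r,a) = Spec k[{m ∈ ℤ² : 0 ≤ m₂, a m₂ ≤ r m₁}]` over every field are resolved by the Hirzebruch–Jung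
tower of two-chart monomial blow-ups; finite type is what places `U(r,a)` in the crux's class —
`LocallyOfFiniteType` is load-bearing by the Disproof's Negative/FiniteTypeLoadBearing).

Gordan's lemma for the two-dimensional cone `σ∨ = {m₂ ≥ 0, a m₂ ≤ r m₁}` (`1 ≤ r`), with an EXPLICIT
finite generating set: the monomials `χ^m` with `m` a lattice point of `σ∨` in the box `m₁ ≤ a + 1`,
`m₂ ≤ r` (this box contains `(1,0)`, `(a,r)` and the Hilbert-basis points `(⌈aρ/r⌉, ρ)`, `0 ≤ ρ < r`).

* `toric_fst_nonneg` — lattice points of `σ∨` have `0 ≤ m₁` (uses `1 ≤ r`);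
* `toric_box_finite` — the box is finite;
* `toric_reduce` — a lattice point of `σ∨` outside the box is `m' + g` with `g = (1,0)` or `g = (a,r)`
  in the box and `m' ∈ σ∨` of smaller `m₁ + m₂`;
* `toric_single_mem_adjoin_box`, `toric_adjoin_box_eq` — hence every `χ^m`, `m ∈ σ∨ ∩ ℤ²`, is a
  product of box monomials, and `k[σ∨ ∩ ℤ²]` is the subalgebra of `k[ℤ²]` generated by the (finitely
  many) box monomials;
* `stub_toric_finiteType` — `k[σ∨ ∩ ℤ²]` is of finite type over `k` (`Subalgebra.fg_iff_finiteType`).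

All folklore (Cox–Little–Schenck 2011, Prop. 1.2.17; Fulton 1993 §1.2); no published fact is used.
-/

-- single-problem summit: the doubled namespace component is forced
set_option linter.dupNamespace false

noncomputable section

namespace Summit.ResolutionOfSingularities.ResolutionOfSingularities.Theorems.FRationalResolution

open CategoryTheory AlgebraicGeometry TopologicalSpace
open Literature.AlgebraicGeometry.Resolution

section Toric

variable (k : Type) [Field k]

/-- The Laurent polynomial ring `k[ℤ²]` (coordinate ring of the 2-torus). -/
local notation3 "Lk" => AddMonoidAlgebra k (ℤ × ℤ)

/-- The lattice points of the dual cone `σ∨ = {m₂ ≥ 0, a m₂ ≤ r m₁}` of `σ = cone((0,1),(r,-a))`. -/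
local notation3 "σS[" r ", " a "]" =>
  {m : ℤ × ℤ | 0 ≤ m.2 ∧ ((a : ℕ) : ℤ) * m.2 ≤ ((r : ℕ) : ℤ) * m.1}

/-- The toric surface algebra `k[σ∨ ∩ ℤ²] ⊆ k[ℤ²]`. -/
local notation3 "TA[" r ", " a "]" =>
  Algebra.adjoin k ((fun m : ℤ × ℤ => AddMonoidAlgebra.single m (1 : k)) '' σS[r, a])

/-- The finite box of generators: lattice points of `σ∨` with `m₁ ≤ a + 1` and `m₂ ≤ r`. -/
local notation3 "σB[" r ", " a "]" =>
  {m : ℤ × ℤ | m ∈ σS[r, a] ∧ m.1 ≤ ((a : ℕ) : ℤ) + 1 ∧ m.2 ≤ ((r : ℕ) : ℤ)}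

/-- Lattice points of `σ∨` have nonnegative first coordinate (as `1 ≤ r`):
`0 ≤ a m₂ ≤ r m₁`. [folklore] -/
theorem toric_fst_nonneg (r a : ℕ) (hr : 1 ≤ r) (m : ℤ × ℤ) (hm : m ∈ σS[r, a]) : 0 ≤ m.1 := by
  have h1 : (0 : ℤ) ≤ (a : ℤ) * m.2 := mul_nonneg (Nat.cast_nonneg a) hm.1
  have h2 : (0 : ℤ) < (r : ℤ) := by exact_mod_cast hr
  exact nonneg_of_mul_nonneg_right (h1.trans hm.2) h2

/-- The box `σ∨ ∩ {m₁ ≤ a + 1, m₂ ≤ r}` is finite (it lies in `[0, a + 1] × [0, r]`). [folklore] -/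
theorem toric_box_finite (r a : ℕ) (hr : 1 ≤ r) : Set.Finite σB[r, a] := by
  refine ((Set.finite_Icc (0 : ℤ) ((a : ℤ) + 1)).prod (Set.finite_Icc (0 : ℤ) (r : ℤ))).subset ?_
  rintro m ⟨hm, h1, h2⟩
  exact ⟨⟨toric_fst_nonneg r a hr m hm, h1⟩, ⟨hm.1, h2⟩⟩

/-- Reduction step: a lattice point `m` of `σ∨` outside the box is `m' + g` with
`g ∈ {(1,0), (a,r)}` (both in the box) and `m' ∈ σ∨` with `m'₁ + m'₂ < m₁ + m₂`: if `m₂ > r`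
subtract `(a, r)` (the defining inequality is invariant), otherwise `m₁ ≥ a + 2` and one may
subtract `(1, 0)` since `a m₂ ≤ a r ≤ r (m₁ - 1)`. [folklore] -/
theorem toric_reduce (r a : ℕ) (hr : 1 ≤ r) (m : ℤ × ℤ) (hm : m ∈ σS[r, a])
    (hb : ¬ (m.1 ≤ ((a : ℕ) : ℤ) + 1 ∧ m.2 ≤ ((r : ℕ) : ℤ))) :
    ∃ g ∈ σB[r, a], ∃ m' ∈ σS[r, a], m = m' + g ∧ m'.1 + m'.2 + 1 ≤ m.1 + m.2 := by
  obtain ⟨hm0, hmc⟩ := hm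
  by_cases h2 : m.2 ≤ (r : ℤ)
  · -- `m₁ ≥ a + 2`: subtract `(1, 0)`
    have h1 : (a : ℤ) + 2 ≤ m.1 := by omega
    have ha : (a : ℤ) * m.2 ≤ (a : ℤ) * (r : ℤ) :=
      mul_le_mul_of_nonneg_left h2 (Nat.cast_nonneg a)
    have hr' : (r : ℤ) * ((a : ℤ) + 2) ≤ (r : ℤ) * m.1 :=
      mul_le_mul_of_nonneg_left h1 (Nat.cast_nonneg r)
    refine ⟨((1 : ℤ), (0 : ℤ)), ⟨⟨le_rfl, by simp⟩, by simp, by simp⟩, (m.1 - 1, m.2), ⟨hm0, ?_⟩,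
      ?_, ?_⟩
    · show (a : ℤ) * m.2 ≤ (r : ℤ) * (m.1 - 1)
      nlinarith [Nat.cast_nonneg (α := ℤ) r]
    · ext <;> simp
    · show m.1 - 1 + m.2 + 1 ≤ m.1 + m.2
      omega
  · -- `m₂ > r`: subtract `(a, r)`
    refine ⟨((a : ℤ), (r : ℤ)), ⟨⟨Nat.cast_nonneg r, (mul_comm _ _).le⟩, by simp, le_rfl⟩,
      (m.1 - a, m.2 - r), ⟨?_, ?_⟩, ?_, ?_⟩
    · show (0 : ℤ) ≤ m.2 - r
      omega
    · show (a : ℤ) * (m.2 - r) ≤ (r : ℤ) * (m.1 - a)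
      linarith
    · ext <;> simp
    · show m.1 - a + (m.2 - r) + 1 ≤ m.1 + m.2
      have : (1 : ℤ) ≤ r := by exact_mod_cast hr
      omega

/-- Every cone monomial `χ^m`, `m ∈ σ∨ ∩ ℤ²`, lies in the subalgebra of `k[ℤ²]` generated by the
box monomials (induction on `m₁ + m₂` along `toric_reduce`, `χ^(m' + g) = χ^m' · χ^g`).
[folklore; CLS2011 Prop. 1.2.17] -/
theorem toric_single_mem_adjoin_box (r a : ℕ) (hr : 1 ≤ r) (m : ℤ × ℤ) (hm : m ∈ σS[r, a]) :
    AddMonoidAlgebra.single m (1 : k) ∈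
      Algebra.adjoin k ((fun m : ℤ × ℤ => AddMonoidAlgebra.single m (1 : k)) '' σB[r, a]) := by
  suffices h : ∀ (n : ℕ) (m : ℤ × ℤ), m ∈ σS[r, a] → m.1 + m.2 < n →
      AddMonoidAlgebra.single m (1 : k) ∈
        Algebra.adjoin k ((fun m : ℤ × ℤ => AddMonoidAlgebra.single m (1 : k)) '' σB[r, a]) by
    have h0 := toric_fst_nonneg r a hr m hm
    have h0' := hm.1
    obtain ⟨n, hn⟩ := Int.eq_ofNat_of_zero_le (show (0 : ℤ) ≤ m.1 + m.2 + 1 by omega)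
    exact h n m hm (by omega)
  intro n
  induction n with
  | zero =>
    intro m hm hn
    have := toric_fst_nonneg r a hr m hm
    have := hm.1
    omega
  | succ n ih =>
    intro m hm hn
    by_cases hb : m.1 ≤ ((a : ℕ) : ℤ) + 1 ∧ m.2 ≤ ((r : ℕ) : ℤ)
    · exact Algebra.subset_adjoin ⟨m, ⟨hm, hb⟩, rfl⟩
    · obtain ⟨g, hg, m', hm', rfl, hlt⟩ := toric_reduce r a hr _ hm hb
      rw [show AddMonoidAlgebra.single (m' + g) (1 : k) =
          AddMonoidAlgebra.single m' 1 * AddMonoidAlgebra.single g 1 by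
        rw [AddMonoidAlgebra.single_mul_single, mul_one]]
      refine Subalgebra.mul_mem _ (ih m' hm' ?_) (Algebra.subset_adjoin ⟨g, hg, rfl⟩)
      simp only [Prod.fst_add, Prod.snd_add] at hn hlt
      omega

/-- `k[σ∨ ∩ ℤ²]` is generated by the finitely many box monomials: the two `Algebra.adjoin`s agree
(`⊆`: the box lies in the cone; `⊇`: `toric_single_mem_adjoin_box`).
[folklore; CLS2011 Prop. 1.2.17] -/
theorem toric_adjoin_box_eq (r a : ℕ) (hr : 1 ≤ r) :
    Algebra.adjoin k ((fun m : ℤ × ℤ => AddMonoidAlgebra.single m (1 : k)) '' σB[r, a]) =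
      TA[r, a] := by
  refine le_antisymm (Algebra.adjoin_mono (Set.image_mono fun m hm => hm.1)) (Algebra.adjoin_le ?_)
  rintro _ ⟨m, hm, rfl⟩
  exact toric_single_mem_adjoin_box k r a hr m hm

/-- STUB (Gordan's lemma for the cone `σ∨`, explicit form): for `1 ≤ r`, `a ≤ r` the algebra
`TA[r,a]` is of finite type over `k` — it is generated by the finitely many monomials `χ^m`,
`m ∈ σ∨ ∩ ℤ²` with `m₁ ≤ a + 1`, `m₂ ≤ r` (among them `χ^(1,0)`, `χ^(a,r)` and `χ^(⌈aρ/r⌉, ρ)`,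
`0 ≤ ρ < r`): for `m ∈ σS[r,a]` outside that box subtract `(a,r)` (if `m₂ > r`) or `(1,0)` (if
`m₂ ≤ r`, `m₁ ≥ a + 2`) and induct on `m₁ + m₂` (`toric_adjoin_box_eq`); a subalgebra generated by
a finite set is of finite type (`Subalgebra.fg_iff_finiteType`). The hypothesis `a ≤ r` is not
needed. [folklore; CLS2011 Prop. 1.2.17] -/
theorem stub_toric_finiteType (r a : ℕ) (hr : 1 ≤ r) (har : a ≤ r) : Algebra.FiniteType k ↥TA[r, a] := by
  have _ := har
  rw [← Subalgebra.fg_iff_finiteType, Subalgebra.fg_def]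
  exact ⟨_, (toric_box_finite r a hr).image _, toric_adjoin_box_eq k r a hr⟩

end Toric

end Summit.ResolutionOfSingularities.ResolutionOfSingularities.Theorems.FRationalResolution

end
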